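import Summits.CriticalPhenomena.PercolationContinuityZ3.Theorems.PercNearOneGluingNoHeavyLowerTailSahiSlotTensorConeDim
import Summits.CriticalPhenomena.PercolationContinuityZ3.Theorems.PercNearOneGluingNoHeavyLowerTailSahiSlotPinnedCert

/-!
# The pinned one-member certificate format is antitone in the dimension

Support file of the one-cut programme (crux `NoHeavyLowerTail`, stmt-CriticalPhenomena-4575; cell `prim-masterthm`, seat P3, gen 21; HIERARCHY §29).
`SahiSlot.PinnedLitCert d n` (…SahiSlotPinnedCert): at order `n + 1`, for every up-set `A` (member `0`, pinned) a nonnegative combination of products of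
one literal per remaining member.  THIS FILE: **`PinnedLitCert.of_succ : PinnedLitCert (d+1) n → PinnedLitCert d n`** and `PinnedLitCert.of_le` — pin the
cylinder over `A`, restrict the certificate to cylinder families (`Lit.eval_comp_tail`), divide by `(n+1)!` (`patternForm_comp_tail`).  With
`LitProdCert.of_succ` (…TensorConeDim) and `PairLitCert.of_succ` (…PairCertDim) all three literal-certificate formats of the slot functional are antitone
in the dimension, like the obligation `SlotPatternPos` itself.  Pure, standard axioms. [this work]
-/

namespace Summit.CriticalPhenomena.PercolationContinuityZ3.Theorems

open Finset Function Equiv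
open Literature.Combinatorics.Sahi2008

namespace SahiSlot

section PinnedDim

variable {d n : ℕ}

/-- `Fin.cons` of cylinders is the cylinder of the `Fin.cons`. [this work] -/
theorem cons_comp_tail (a : Q d (n + 1) → ℝ) (u : Fin n → Q d (n + 1) → ℝ) :
    (Fin.cons (a ∘ Fin.tail) (fun i => u i ∘ Fin.tail) : Fin (n + 1) → Q (d + 1) (n + 1) → ℝ) =
      fun i => (Fin.cons a u : Fin (n + 1) → Q d (n + 1) → ℝ) i ∘ Fin.tail := by
  funext i
  refine Fin.cases ?_ (fun j => ?_) i
  · simp only [Fin.cons_zero]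
  · simp only [Fin.cons_succ]

/-- **The pinned format is antitone in the dimension**: `PinnedLitCert (d+1) n → PinnedLitCert d n`. [this work] -/
theorem PinnedLitCert.of_succ (h : PinnedLitCert (d + 1) n) : PinnedLitCert d n := by
  intro A hA
  obtain ⟨k, coef, J, hcoef, hid⟩ := h (cylSet A) (isUpperSet_cylSet hA)
  set c : ℝ := (Fintype.card (Perm (Fin (n + 1))) : ℝ) with hc
  have hcpos : 0 < c := by rw [hc]; exact_mod_cast Fintype.card_pos
  refine ⟨k, fun j => coef j / c * ∏ i, (if (J j i).tailOK then (1 : ℝ) else 0), fun j i => (J j i).tailLit, ?_, ?_⟩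
  · intro j
    exact mul_nonneg (div_nonneg (hcoef j) hcpos.le) (prod_nonneg fun i _ => by split_ifs <;> norm_num)
  · intro U hU
    have h1 := hid (fun i => cylSet (U i)) fun i => isUpperSet_cylSet (hU i)
    simp_rw [setInd_cylSet] at h1
    rw [cons_comp_tail, patternForm_comp_tail] at h1
    simp_rw [Lit.eval_comp_tail] at h1
    rw [← hc] at h1
    have key : ∀ j : Fin k, (∏ i, if (J j i).tailOK then (J j i).tailLit.eval (setInd (U i)) else 0) =
        (∏ i, if (J j i).tailOK then (1 : ℝ) else 0) * ∏ i, (J j i).tailLit.eval (setInd (U i)) := by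
      intro j
      rw [← prod_mul_distrib]
      refine prod_congr rfl fun i _ => ?_
      split_ifs <;> simp
    simp_rw [key] at h1
    apply mul_left_cancel₀ hcpos.ne'
    rw [h1, mul_sum]
    refine sum_congr rfl fun j _ => ?_
    field_simp

/-- `PinnedLitCert d' n → PinnedLitCert d n` for `d ≤ d'`. [this work] -/
theorem PinnedLitCert.of_le {d d' : ℕ} (hdd' : d ≤ d') (h : PinnedLitCert d' n) : PinnedLitCert d n := by
  obtain ⟨k, rfl⟩ := Nat.exists_eq_add_of_le hdd'
  induction k with
  | zero => simpa using h
  | succ k ih => exact ih (Nat.le_add_right d k) (PinnedLitCert.of_succ (by rw [← Nat.add_assoc] at h; exact h))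

end PinnedDim

end SahiSlot

end Summit.CriticalPhenomena.PercolationContinuityZ3.Theorems
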